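import Summits.CriticalPhenomena.PercolationContinuityZ3.Theorems.PercNearOneGluingNoHeavyLowerTailAntipodalR1Nested
import Summits.CriticalPhenomena.PercolationContinuityZ3.Theorems.PercNearOneGluingNoHeavyLowerTailAntipodalR1TwoCutPaths
import HarnessLib

/-!
# The pocket flip, I: the pocket of a terminal and the flipped colouring

Support file for `stmt-CriticalPhenomena-4575` (memo `prim-gen-kcluster/KCLUSTER-gen78.md` §3.5 and
`KCLUSTER-gen79.md` §1; conjecture ANTI₁-GRADED of `KCLUSTER-gen52.md` §3, whose per-level form on irreducible
instances is the hypothesis `Hirr` of `AntipodalR1.card_lSet_grade_le_of_irreducible`).  No definitions, no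
named facts, no sorries.  Vocabulary of `AntipodalR1` (gen 62): `clus ends x true a = O_a`,
`clus ends x false a = K_a`, `region ends x a c` = the vertices joined to `c` by a support path avoiding `K_a`,
`L = lSet`, `R(b,c) = rSet`.

For a colouring `x` with `c ∉ K_a` the **pocket** of `c` is `Q = region ends x a c`: the component of `c` in
the support graph minus `K_a`.  Every support edge leaving `Q` ends in `K_a` and is OPEN
(`AntipodalR1.mem_clus_of_adj_pocket`, `AntipodalR1.open_of_adj_pocket`).  The **pocket flip** is the colouring
`y = Φ_c(x)` that reverses the colour of every edge touching `Q` (hypothesis form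
`hy : ∀ e, y e = if (∃ v, v ∈ ends e ∧ v ∈ region ends x a c) then !x e else x e`).  This file proves,
for `x ∈ L`:
* `O_a(y) ⊆ O_a(x) ∖ Q` and every vertex of `O_a(y)` is joined to `a` by an open path of `x` avoiding `Q`
  (`AntipodalR1.pocketFlip_clus_true_subset`); `K_a(x) ⊆ K_a(y) ⊆ K_a(x) ∪ Q`
  (`AntipodalR1.clus_false_subset_pocketFlip`, `AntipodalR1.pocketFlip_clus_false_subset`); `c ∈ K_a(y)`
  (`AntipodalR1.apex_mem_pocketFlip_clus_false`);
* hence, if the pocket is **singly attached** — every vertex outside `Q` adjacent to `Q` is joined to `a` by an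
  open path of `x` avoiding `Q` — then `y ∈ R(b,c)` (`AntipodalR1.pocketFlip_mem_rSet`), and the pocket is
  recovered from `y` as the component of `c` in the support graph minus `O_a(y)`:
  `region ends x a c = region ends ȳ a c` (`AntipodalR1.pocket_eq_region_flip`), so `Φ_c` is injective on the
  singly attached part of `L` (`AntipodalR1.pocketFlip_injOn`).
Part II (`…AntipodalR1PocketGrade`) shows that `Φ_c` preserves the grade `k(O)+k(K)` on singly attached elements;
part III (`…AntipodalR1PocketInvolution`) assembles the graded injection and the reduction of ANTI₁-GRADED to the
multiply attached residue.  [this work]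
-/

namespace Summit.CriticalPhenomena.PercolationContinuityZ3.Theorems

namespace AntipodalR1

open Finset Relation

variable {V ι : Type*}

section Pocket

variable {ends : ι → Sym2 V} {x y : ι → Bool} {a b c : V}

/-! ### The pocket of `c` -/

/-- A support-neighbour of a pocket vertex that avoids `K_a` lies in the pocket. [this work] -/
theorem mem_pocket_of_adj (hc : c ∉ clus ends x false a) {v w : V} {e : ι}
    (hv : v ∈ region ends x a c) (he : ends e = s(v, w)) (hw : w ∉ clus ends x false a) :
    w ∈ region ends x a c :=
  ReflTransGen.tail hv ⟨⟨e, he⟩, not_mem_clus_of_region hc hv, hw⟩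

/-- A support-neighbour of a pocket vertex lies in the pocket or in `K_a`. [this work] -/
theorem mem_clus_of_adj_pocket (hc : c ∉ clus ends x false a) {v w : V} {e : ι}
    (hv : v ∈ region ends x a c) (he : ends e = s(v, w)) (hw : w ∉ region ends x a c) :
    w ∈ clus ends x false a := by
  by_contra h
  exact hw (mem_pocket_of_adj hc hv he h)

/-- Every support edge leaving the pocket is open. [this work] -/
theorem open_of_adj_pocket (hc : c ∉ clus ends x false a) {v w : V} {e : ι}
    (hv : v ∈ region ends x a c) (he : ends e = s(v, w)) (hw : w ∉ region ends x a c) :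
    x e = true := by
  cases hxe : x e
  · exact absurd (clus_step (mem_clus_of_adj_pocket hc hv he hw) ⟨e, hxe, by rw [he, Sym2.eq_swap]⟩)
      (not_mem_clus_of_region hc hv)
  · rfl

/-- The apex is not in the pocket. [this work] -/
theorem apex_not_mem_pocket (hc : c ∉ clus ends x false a) : a ∉ region ends x a c :=
  fun h => not_mem_clus_of_region hc h ReflTransGen.refl

/-- An edge touching the pocket with an end outside the pocket is open, and that end lies in `K_a`.
[this work] -/
theorem open_and_mem_clus_of_touch (hc : c ∉ clus ends x false a) {e : ι} {u : V}
    (ht : ∃ v, v ∈ ends e ∧ v ∈ region ends x a c) (hu : u ∈ ends e) (huQ : u ∉ region ends x a c) :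
    x e = true ∧ u ∈ clus ends x false a := by
  obtain ⟨v, hv, hvQ⟩ := ht
  obtain ⟨w, hw⟩ := Sym2.mem_iff_exists.1 hv
  have hu' : u = v ∨ u = w := by rw [hw] at hu; exact Sym2.mem_iff.1 hu
  rcases hu' with rfl | rfl
  · exact absurd hvQ huQ
  · exact ⟨open_of_adj_pocket hc hvQ hw huQ, mem_clus_of_adj_pocket hc hvQ hw huQ⟩

/-- A closed edge touching the pocket has both ends in the pocket. [this work] -/
theorem mem_pocket_of_touch_closed (hc : c ∉ clus ends x false a) {e : ι} {u : V}
    (ht : ∃ v, v ∈ ends e ∧ v ∈ region ends x a c) (hxe : x e = false) (hu : u ∈ ends e) :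
    u ∈ region ends x a c := by
  by_contra huQ
  have := (open_and_mem_clus_of_touch hc ht hu huQ).1
  rw [hxe] at this
  exact Bool.false_ne_true this

/-- An edge with both ends outside the pocket does not touch it. [this work] -/
theorem not_touch_of_ends {e : ι} {u w : V} (he : ends e = s(u, w)) (hu : u ∉ region ends x a c)
    (hw : w ∉ region ends x a c) : ¬ ∃ v, v ∈ ends e ∧ v ∈ region ends x a c := by
  rintro ⟨v, hv, hvQ⟩
  rw [he, Sym2.mem_iff] at hv
  rcases hv with rfl | rfl
  · exact hu hvQ
  · exact hw hvQ

/-! ### The flipped colouring -/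

open Classical in
/-- Value of the pocket flip on an edge touching the pocket. [this work] -/
theorem pocketFlip_of_touch
    (hy : ∀ e, y e = if (∃ v, v ∈ ends e ∧ v ∈ region ends x a c) then !x e else x e) {e : ι}
    (ht : ∃ v, v ∈ ends e ∧ v ∈ region ends x a c) : y e = !x e := by
  rw [hy e, if_pos ht]

open Classical in
/-- Value of the pocket flip on an edge not touching the pocket. [this work] -/
theorem pocketFlip_of_not_touch
    (hy : ∀ e, y e = if (∃ v, v ∈ ends e ∧ v ∈ region ends x a c) then !x e else x e) {e : ι}
    (ht : ¬ ∃ v, v ∈ ends e ∧ v ∈ region ends x a c) : y e = x e := by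
  rw [hy e, if_neg ht]

open Classical in
/-- **`O_a(y)` lies outside the pocket**, and each of its vertices is joined to `a` by an open path of `x`
avoiding the pocket. [this work] -/
theorem pocketFlip_clus_true_subset (hc : c ∉ clus ends x false a)
    (hy : ∀ e, y e = if (∃ v, v ∈ ends e ∧ v ∈ region ends x a c) then !x e else x e) {v : V}
    (hv : v ∈ clus ends y true a) :
    v ∉ region ends x a c ∧ ReflTransGen (fun u w => w ∈ nbr ends x true u ∧
      u ∉ region ends x a c ∧ w ∉ region ends x a c) a v := by
  rw [mem_clus] at hv
  induction hv with
  | refl => exact ⟨apex_not_mem_pocket hc, ReflTransGen.refl⟩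
  | @tail u w _ huw ih =>
    obtain ⟨huQ, hpath⟩ := ih
    obtain ⟨e, hye, he⟩ := huw
    have hnt : ¬ ∃ v, v ∈ ends e ∧ v ∈ region ends x a c := by
      intro ht
      have hxe := (open_and_mem_clus_of_touch hc ht (by rw [he]; exact Sym2.mem_mk_left _ _) huQ).1
      rw [pocketFlip_of_touch hy ht, hxe] at hye
      exact Bool.false_ne_true hye
    have hxe : x e = true := by rw [← pocketFlip_of_not_touch hy hnt]; exact hye
    have hwQ : w ∉ region ends x a c := fun hwQ =>
      hnt ⟨w, by rw [he]; exact Sym2.mem_mk_right _ _, hwQ⟩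
    exact ⟨hwQ, hpath.tail ⟨⟨e, hxe, he⟩, huQ, hwQ⟩⟩

open Classical in
/-- An open path of `x` avoiding the pocket is an open path of the flipped colouring. [this work] -/
theorem mem_pocketFlip_clus_true_of_path
    (hy : ∀ e, y e = if (∃ v, v ∈ ends e ∧ v ∈ region ends x a c) then !x e else x e) {v : V}
    (hv : ReflTransGen (fun u w => w ∈ nbr ends x true u ∧
      u ∉ region ends x a c ∧ w ∉ region ends x a c) a v) :
    v ∈ clus ends y true a := by
  induction hv with
  | refl => exact ReflTransGen.refl
  | @tail u w _ huw ih =>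
    obtain ⟨⟨e, hxe, he⟩, huQ, hwQ⟩ := huw
    have hye : y e = true := by rw [pocketFlip_of_not_touch hy (not_touch_of_ends he huQ hwQ), hxe]
    exact clus_step ih ⟨e, hye, he⟩

open Classical in
/-- `O_a(y) ⊆ O_a(x)`. [this work] -/
theorem pocketFlip_clus_true_subset_clus (hc : c ∉ clus ends x false a)
    (hy : ∀ e, y e = if (∃ v, v ∈ ends e ∧ v ∈ region ends x a c) then !x e else x e) {v : V}
    (hv : v ∈ clus ends y true a) : v ∈ clus ends x true a :=
  path_mono (fun _ _ h => h.1) (pocketFlip_clus_true_subset hc hy hv).2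

open Classical in
/-- **`K_a(x) ⊆ K_a(y)`**: closed edges at `K_a(x)` do not touch the pocket. [this work] -/
theorem clus_false_subset_pocketFlip (hc : c ∉ clus ends x false a)
    (hy : ∀ e, y e = if (∃ v, v ∈ ends e ∧ v ∈ region ends x a c) then !x e else x e) {v : V}
    (hv : v ∈ clus ends x false a) : v ∈ clus ends y false a := by
  rw [mem_clus] at hv
  induction hv with
  | refl => exact ReflTransGen.refl
  | @tail u w hau huw ih =>
    obtain ⟨e, hxe, he⟩ := huw
    have hnt : ¬ ∃ v, v ∈ ends e ∧ v ∈ region ends x a c := by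
      intro ht
      have huQ := mem_pocket_of_touch_closed hc ht hxe (by rw [he]; exact Sym2.mem_mk_left _ _)
      exact not_mem_clus_of_region hc huQ hau
    have hye : y e = false := by rw [pocketFlip_of_not_touch hy hnt, hxe]
    exact clus_step ih ⟨e, hye, he⟩

open Classical in
/-- Open paths of `x` inside the pocket become closed paths of `y` hanging from `K_a(y)`: every vertex of
`O_a(x) ∩ Q` lies in `K_a(y)`. [this work] -/
theorem mem_pocketFlip_clus_false_of_mem_pocket (hc : c ∉ clus ends x false a)
    (hy : ∀ e, y e = if (∃ v, v ∈ ends e ∧ v ∈ region ends x a c) then !x e else x e) {v : V}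
    (hv : v ∈ clus ends x true a) (hvQ : v ∈ region ends x a c) : v ∈ clus ends y false a := by
  rw [mem_clus] at hv
  induction hv with
  | refl => exact absurd hvQ (apex_not_mem_pocket hc)
  | @tail u w _ huw ih =>
    obtain ⟨e, hxe, he⟩ := huw
    have ht : ∃ v, v ∈ ends e ∧ v ∈ region ends x a c := ⟨w, by rw [he]; exact Sym2.mem_mk_right _ _, hvQ⟩
    have hye : y e = false := by rw [pocketFlip_of_touch hy ht, hxe]; rfl
    have hu : u ∈ clus ends y false a := by
      by_cases huQ : u ∈ region ends x a c
      · exact ih huQ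
      · exact clus_false_subset_pocketFlip hc hy
          (mem_clus_of_adj_pocket hc hvQ (by rw [he, Sym2.eq_swap]) huQ)
    exact clus_step hu ⟨e, hye, he⟩

open Classical in
/-- **`c ∈ K_a(y)`** when `c ∈ O_a(x)`. [this work] -/
theorem apex_mem_pocketFlip_clus_false (hc : c ∉ clus ends x false a) (hcO : c ∈ clus ends x true a)
    (hy : ∀ e, y e = if (∃ v, v ∈ ends e ∧ v ∈ region ends x a c) then !x e else x e) :
    c ∈ clus ends y false a :=
  mem_pocketFlip_clus_false_of_mem_pocket hc hy hcO ReflTransGen.refl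

open Classical in
/-- **`K_a(y) ⊆ K_a(x) ∪ Q`**. [this work] -/
theorem pocketFlip_clus_false_subset (hc : c ∉ clus ends x false a)
    (hy : ∀ e, y e = if (∃ v, v ∈ ends e ∧ v ∈ region ends x a c) then !x e else x e) {v : V}
    (hv : v ∈ clus ends y false a) : v ∈ clus ends x false a ∨ v ∈ region ends x a c := by
  rw [mem_clus] at hv
  induction hv with
  | refl => exact Or.inl ReflTransGen.refl
  | @tail u w _ huw ih =>
    obtain ⟨e, hye, he⟩ := huw
    by_cases ht : ∃ v, v ∈ ends e ∧ v ∈ region ends x a c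
    · by_cases hwQ : w ∈ region ends x a c
      · exact Or.inr hwQ
      · exact Or.inl (open_and_mem_clus_of_touch hc ht (by rw [he]; exact Sym2.mem_mk_right _ _) hwQ).2
    · have hxe : x e = false := by rw [← pocketFlip_of_not_touch hy ht]; exact hye
      have huQ : u ∉ region ends x a c := fun huQ =>
        ht ⟨u, by rw [he]; exact Sym2.mem_mk_left _ _, huQ⟩
      rcases ih with huK | huQ'
      · exact Or.inl (clus_step huK ⟨e, hxe, he⟩)
      · exact absurd huQ' huQ

open Classical in
/-- Under single attachment, every vertex of `O_a(x)` outside the pocket stays in `O_a(y)`. [this work] -/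
theorem mem_pocketFlip_clus_true_of_not_mem_pocket
    (hy : ∀ e, y e = if (∃ v, v ∈ ends e ∧ v ∈ region ends x a c) then !x e else x e)
    (hatt : ∀ w, w ∉ region ends x a c → (∃ e u, ends e = s(w, u) ∧ u ∈ region ends x a c) →
      ReflTransGen (fun u w => w ∈ nbr ends x true u ∧
        u ∉ region ends x a c ∧ w ∉ region ends x a c) a w)
    {v : V} (hv : v ∈ clus ends x true a) (hvQ : v ∉ region ends x a c) : v ∈ clus ends y true a := by
  rw [mem_clus] at hv
  induction hv with
  | refl => exact ReflTransGen.refl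
  | @tail u w _ huw ih =>
    obtain ⟨e, hxe, he⟩ := huw
    by_cases huQ : u ∈ region ends x a c
    · exact mem_pocketFlip_clus_true_of_path hy (hatt w hvQ ⟨e, u, by rw [he, Sym2.eq_swap], huQ⟩)
    · have hye : y e = true := by rw [pocketFlip_of_not_touch hy (not_touch_of_ends he huQ hvQ), hxe]
      exact clus_step (ih huQ) ⟨e, hye, he⟩

open Classical in
/-- **The pocket flip of a singly attached element of `L` lies in `R(b,c)`.** [this work] -/
theorem pocketFlip_mem_rSet [Fintype ι] [DecidableEq ι] (hx : x ∈ lSet ends a b c)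
    (hy : ∀ e, y e = if (∃ v, v ∈ ends e ∧ v ∈ region ends x a c) then !x e else x e)
    (hatt : ∀ w, w ∉ region ends x a c → (∃ e u, ends e = s(w, u) ∧ u ∈ region ends x a c) →
      ReflTransGen (fun u w => w ∈ nbr ends x true u ∧
        u ∉ region ends x a c ∧ w ∉ region ends x a c) a w) :
    y ∈ rSet ends a b c := by
  obtain ⟨hbO, hbK, hcO, hcK, hsep⟩ := mem_lSet.1 hx
  have hbQ : b ∉ region ends x a c := fun h => hsep (region_symm h)
  refine mem_rSet.2 ⟨mem_pocketFlip_clus_true_of_not_mem_pocket hy hatt hbO hbQ, ?_,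
    apex_mem_pocketFlip_clus_false hcK hcO hy, fun h => (pocketFlip_clus_true_subset hcK hy h).1 ReflTransGen.refl⟩
  intro hbKy
  rcases pocketFlip_clus_false_subset hcK hy hbKy with h | h
  · exact hbK h
  · exact hbQ h

/-! ### Recovering the pocket from the flipped colouring -/

open Classical in
/-- **Decoding the pocket.**  Under single attachment the pocket of `c` (w.r.t. `K_a(x)`) is the component of
`c` in the support graph minus `O_a(y)`, i.e. `region ends ȳ a c` for the complementary colouring `ȳ`.
[this work] -/
theorem pocket_eq_region_flip (hc : c ∉ clus ends x false a)
    (hy : ∀ e, y e = if (∃ v, v ∈ ends e ∧ v ∈ region ends x a c) then !x e else x e)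
    (hatt : ∀ w, w ∉ region ends x a c → (∃ e u, ends e = s(w, u) ∧ u ∈ region ends x a c) →
      ReflTransGen (fun u w => w ∈ nbr ends x true u ∧
        u ∉ region ends x a c ∧ w ∉ region ends x a c) a w) :
    region ends x a c = region ends (fun i => !y i) a c := by
  have hOQ : ∀ {v}, v ∈ region ends x a c → v ∉ clus ends (fun i => !y i) false a := by
    intro v hvQ hvO
    rw [mem_clus_flip] at hvO
    exact (pocketFlip_clus_true_subset hc hy hvO).1 hvQ
  ext v
  constructor
  · intro hv
    rw [mem_region] at hv ⊢
    induction hv with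
    | refl => exact ReflTransGen.refl
    | @tail u w hcu huw ih =>
      obtain ⟨⟨e, he⟩, huK, hwK⟩ := huw
      exact ih.tail ⟨⟨e, he⟩, hOQ hcu, hOQ (mem_pocket_of_adj hc hcu he hwK)⟩
  · intro hv
    rw [mem_region] at hv
    induction hv with
    | refl => exact ReflTransGen.refl
    | @tail u w _ huw ih =>
      obtain ⟨⟨e, he⟩, _, hwO⟩ := huw
      by_contra hwQ
      apply hwO
      rw [mem_clus_flip]
      exact mem_pocketFlip_clus_true_of_path hy (hatt w hwQ ⟨e, u, by rw [he, Sym2.eq_swap], ih⟩)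

open Classical in
/-- **Injectivity of the pocket flip on singly attached colourings.**  Two colourings (with `c ∉ K_a`) whose
pockets are singly attached and whose pocket flips coincide are equal. [this work] -/
theorem pocketFlip_injOn {x₁ x₂ : ι → Bool} (hc₁ : c ∉ clus ends x₁ false a) (hc₂ : c ∉ clus ends x₂ false a)
    (hy₁ : ∀ e, y e = if (∃ v, v ∈ ends e ∧ v ∈ region ends x₁ a c) then !x₁ e else x₁ e)
    (hy₂ : ∀ e, y e = if (∃ v, v ∈ ends e ∧ v ∈ region ends x₂ a c) then !x₂ e else x₂ e)
    (hatt₁ : ∀ w, w ∉ region ends x₁ a c → (∃ e u, ends e = s(w, u) ∧ u ∈ region ends x₁ a c) →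
      ReflTransGen (fun u w => w ∈ nbr ends x₁ true u ∧
        u ∉ region ends x₁ a c ∧ w ∉ region ends x₁ a c) a w)
    (hatt₂ : ∀ w, w ∉ region ends x₂ a c → (∃ e u, ends e = s(w, u) ∧ u ∈ region ends x₂ a c) →
      ReflTransGen (fun u w => w ∈ nbr ends x₂ true u ∧
        u ∉ region ends x₂ a c ∧ w ∉ region ends x₂ a c) a w) :
    x₁ = x₂ := by
  have hQ : region ends x₁ a c = region ends x₂ a c := by
    rw [pocket_eq_region_flip hc₁ hy₁ hatt₁, pocket_eq_region_flip hc₂ hy₂ hatt₂]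
  funext e
  have h1 := hy₁ e
  have h2 := hy₂ e
  rw [hQ] at h1
  by_cases ht : ∃ v, v ∈ ends e ∧ v ∈ region ends x₂ a c
  · rw [if_pos ht] at h1 h2
    exact Bool.not_inj (h1.symm.trans h2)
  · rw [if_neg ht] at h1 h2
    exact h1.symm.trans h2

end Pocket

end AntipodalR1

end Summit.CriticalPhenomena.PercolationContinuityZ3.Theorems
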